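import Literature.AnabelianGeometry.AbsoluteAnabelian.AbsTopIII.FrobeniusPictureMLFCores
import Literature.AnabelianGeometry.AbsoluteAnabelian.RigidFunctors

/-!
# [AbsTopIII] Corollary 3.6 (v), first part — DISCHARGE: `□` is a nexus; total `□`-rigidity

Proof-only companion (kind=proof; no new notions) of `AbsTopIII/FrobeniusPictureMLF.lean` (seat
abc-iut-L4-t5; statement core drafted by abc-iut-L4-t2) for S. Mochizuki, *Topics in Absolute
Anabelian Geometry III*, Corollary 3.6 (v) p.80 (bib key `MochizukiAbsTopIII2015`; kurims manuscript
`paper:url-5493eb38cbb7`): "The unique vertex `□` of the second row of `𝒟` is a nexus of `Γ⃗_𝒟`.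
Moreover, `𝒟` is totally `□`-rigid".  Typed by t5 as
`LogFrobeniusData.NexusRigidStmt Δ := Δ.diagram.IsTotallyNexusRigid .nexus {a | a.row = 1}`.

That `□` is a nexus is seat abc-iut-L4-t5's `LogFrobeniusData.isNexus_nexus` /
`nexusRigidStmt_iff` (`FrobeniusPictureMLFCores.lean`, imported); this file adds the second half:
* `LogFrobeniusData.nexusRigidStmt_of` — the total `□`-rigidity of the pre-nexus portion
  `𝒟_{≤□}` (first row + `□`: categories `𝒳` (resp. `X₁`), functors `𝔩𝔬𝔤`, `id_⋎`) PROVED from the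
  id-rigidity of the vertex categories and the rigidity of `id_⋎` — exactly the printed reduction
  "The total `□`-rigidity in question follows immediately from Proposition 3.2, (iv)" (p.82):
  Prop 3.2 (iv) is what makes `𝒞^{MLF-sB}_T` id-rigid; the rigidity of `𝔩𝔬𝔤` is DERIVED here from
  `𝔩𝔬𝔤 ≅ 𝟭` (`logIsoId`, Prop 3.2 (v)) and id-rigidity (`isRigidFunctor_of_iso`, `RigidFunctors.lean`).  For abstract
  input data the id-rigidity of `𝒳`, `X₁` and the rigidity of `toNexus` are hypotheses (in Cor 3.6
  proper `X₁ = 𝒳`, `toNexus = 𝟭`, so they reduce to the single input "𝒳 is id-rigid").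
Nothing here takes a side on inter-universal Teichmüller theory; [AbsTopIII] is a refereed paper.
-/

namespace Literature.AnabelianGeometry.AbsoluteAnabelian

open _root_.CategoryTheory _root_.Quiver

universe v u

namespace LFVertex

/-- A vertex of rows 3–6 is not in the pre-nexus portion `{⋎ ∈ L} ∪ {□}`.
[cite: MochizukiAbsTopIII2015, Corollary 3.6 (v) p.80] -/
theorem not_mem_preNexus {a : LFVertex} (h : 3 ≤ a.row) :
    a ∉ ({a : LFVertex | a.row = 1} ∪ {LFVertex.nexus} : Set LFVertex) := by
  rintro (h1 | h2)
  · have h1' : a.row = 1 := h1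
    omega
  · have h2' : a = nexus := h2
    subst h2'
    exact absurd h (by decide)

end LFVertex

namespace LogFrobeniusData

open DiagramOfCategories

variable (Δ : LogFrobeniusData.{u})

/-- **Cor. 3.6 (v)**, first part, PROVED from id-rigidity: "`□` is a nexus of `Γ⃗_𝒟`. Moreover, `𝒟`
is totally `□`-rigid" — given that the categories `X₁` (first row) and `𝒳` (at `□`) are id-rigid
(for the MLF model: Prop 3.2 (iv)) and that `toNexus = id_⋎` is rigid (automatic when it is `𝟭`);
the rigidity of `𝔩𝔬𝔤` follows from `𝔩𝔬𝔤 ≅ 𝟭` (Prop 3.2 (v)).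
[cite: MochizukiAbsTopIII2015, Corollary 3.6 (v) pp.80–82] -/
theorem nexusRigidStmt_of (hX₁ : IsIdRigid Δ.X₁) (hX : IsIdRigid Δ.X)
    (htn : IsRigidFunctor Δ.toNexus) : Δ.NexusRigidStmt := by
  refine Δ.nexusRigidStmt_iff.2 ⟨?_, ?_⟩
  · -- vertex-rigidity of the pre-nexus portion: categories `X₁` (first row) and `𝒳` (`□`)
    rintro ⟨a, ha⟩
    cases a with
    | row1 n => exact hX₁
    | nexus => exact hX
    | third => exact absurd ha (LFVertex.not_mem_preNexus (Nat.le_of_ble_eq_true rfl))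
    | fourth => exact absurd ha (LFVertex.not_mem_preNexus (Nat.le_of_ble_eq_true rfl))
    | fifth => exact absurd ha (LFVertex.not_mem_preNexus (Nat.le_of_ble_eq_true rfl))
    | sixth => exact absurd ha (LFVertex.not_mem_preNexus (Nat.le_of_ble_eq_true rfl))
  · -- edge-rigidity: the functors `𝔩𝔬𝔤` (≅ 𝟭, hence rigid) and `id_⋎`
    rintro ⟨a, ha⟩ ⟨b, hb⟩ e
    cases a <;> cases b <;>
      first
      | exact (PEmpty.elim e : _)
      | exact absurd hb (LFVertex.not_mem_preNexus (Nat.le_of_ble_eq_true rfl))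
      | exact absurd ha (LFVertex.not_mem_preNexus (Nat.le_of_ble_eq_true rfl))
      | exact isRigidFunctor_of_iso Δ.logIsoId.symm hX₁
      | exact htn

/-- **Cor. 3.6 (v)**, first part, from the SINGLE printed input: when `toNexus : X₁ ⥤ 𝒳` is an
equivalence (in Cor. 3.6 proper `X₁ = 𝒳`, `toNexus = 𝟭`), total `□`-rigidity of `𝒟` follows from the
id-rigidity of `𝒳` alone — "follows immediately from Proposition 3.2, (iv)" (p.82): `X₁ ≌ 𝒳` is
then id-rigid and the fully faithful `toNexus` is rigid (`RigidFunctors.lean`).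
[cite: MochizukiAbsTopIII2015, Corollary 3.6 (v) pp.80–82] -/
theorem nexusRigidStmt_of_isEquivalence [Δ.toNexus.IsEquivalence] (hX : IsIdRigid Δ.X) :
    Δ.NexusRigidStmt :=
  have hX₁ : IsIdRigid Δ.X₁ := isIdRigid_of_equivalence Δ.toNexus.asEquivalence hX
  Δ.nexusRigidStmt_of hX₁ hX (isRigidFunctor_of_full_faithful _ hX₁)

end LogFrobeniusData

end Literature.AnabelianGeometry.AbsoluteAnabelian
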